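import Mathlib
import Literature.Computability.Complexity.RangeAvoidance
import Literature.Computability.Complexity.SignDegreeXor
import Summits.PneNP.PneNP.Theorems.PstarIsolation
import Summits.PneNP.PneNP.Theorems.PstarIsolationBound
import Summits.PneNP.PneNP.Theorems.PstarIsolationRobust
import Summits.PneNP.PneNP.Theorems.PstarIsolationLocal
import Summits.PneNP.PneNP.Theorems.PstarIsolationDegrees

/-!
# Isolation of the all-ones range point of a pure `P⋆` local map — defect tolerance (ROUND-20 item U20, core)

FRONTIER range-avoidance ladder, rung F-N3(ψ) and its extension to the uniform random model (cell `pnp-ideate`,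
ROUND-20 SEED §5 item U20; restricted-model algorithmics — nothing here bears on `P` vs `NP`).

In the uniform random model at fixed stretch `C` the occupancy `occ(v) = degL v + degA v` of a variable fluctuates by
`±Θ(√C)` and a constant fraction of the variables violate any per-vertex occupancy bound; moreover micro-structures of
low-occupancy variables defeat isolation at SOME outputs with probability `e^{−Θ(C)}`.  So a defect-tolerant isolation
theorem must be PER OUTPUT `i` and use AGGREGATE occupancy on large sets.  This file proves the deterministic core, on
top of the localisation `PstarIsolationLocal` (the promises are needed only on shadow-connected sets `W` with
`i ∈ Ψ(W)`):

* `onesFlip_not_mem_range_of_two_le` — the abstract local criterion: if every shadow-connected `W` with `i ∈ Ψ(W)`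
  flips at least two outputs, then `1ᵐ ⊕ e_i ∉ Range`;
* `two_le_flipped_card_of_boundA` — SMALL sets are certified by the counting bound (A) alone:
  `volL(W) + volA(W) ≥ 2eL(W) + eA(W) + 2eLA(W) + 2 ⇒ |Ψ(W)| ≥ 2` (a finite condition per set);
* `onesFlip_not_mem_range_split` — size split at a threshold `R`: bound (A) below `R`, the robust promise
  `PseudoRandomWAt (1/50) 2 2` (whose occupancy clause is already AGGREGATE) at and above `R`;
* shadow balls (`shadowStep`, `shadowBall`) and `subset_shadowBall_of_connected`: a shadow-connected `W ∋ v₀` lies in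
  the ball of radius `|W| − 1` around `v₀`;
* `two_le_flipped_card_of_occ` — regime 1 of K2⁺ from per-vertex occupancy ON `W` ONLY plus upper discrepancy;
* `onesFlip_not_mem_range_of_defectFar` — the packaged criterion: if every variable within shadow-distance `R − 1` of
  output `i` has occupancy `≥ (1−1/50)·4C`, upper discrepancy holds, and the robust promise holds at the shadow-connected
  sets of size `≥ R` through `i`, then `1ᵐ ⊕ e_i` is outside the range (`m ≥ 1600 n`, `10R ≤ 3n`).
-/

set_option linter.dupNamespace false

open Finset Literature.Computability.Complexity
open Summit.PneNP.PneNP.Theorems.PstarIsolation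
open Summit.PneNP.PneNP.Theorems.PstarIsolationBound (AllOnesIsolated)
open Summit.PneNP.PneNP.Theorems.PstarIsolationRobust (PseudoRandomW flipInequalityA)
open Summit.PneNP.PneNP.Theorems.PstarIsolationLocal
open Summit.PneNP.PneNP.Theorems.PstarIsolationDegrees (degL degA volL_eq_sum_degL volA_eq_sum_degA)

namespace Summit.PneNP.PneNP.Theorems.PstarIsolationDefects

variable {n m : ℕ}

/-! ## The abstract local criterion -/

/-- **Local criterion, abstract form.**  If every shadow-connected vertex set `W` with `i ∈ Ψ(W)` flips at least two
outputs, then `1ᵐ ⊕ e_i` is outside the range. -/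
theorem onesFlip_not_mem_range_of_two_le (I : LocalMap 4 n m) (hI : I.IsPure xorAndPred) (i : Fin m)
    (h : ∀ W : Finset (Fin n), ShadowConnected I W → i ∈ flipped I W → 2 ≤ (flipped I W).card) :
    onesFlip i ∉ I.range := by
  rintro ⟨x, hx⟩
  set U : Finset (Fin n) := univ.filter fun v => x v = false with hU
  have hcard : (flipped I U).card = 1 := flipped_card_of_preimage I x i hx
  have hi : i ∈ flipped I U := mem_flipped_of_preimage I x i hx
  obtain ⟨W, -, hconn, -, hiW, hsub⟩ := exists_connected_part I hI i U.card U le_rfl hi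
  have h2 := h W hconn hiW
  have hle : (flipped I W).card ≤ (flipped I U).card := Finset.card_le_card hsub
  omega

/-- A set flipping output `i` is non-empty. -/
theorem nonempty_of_mem_flipped (I : LocalMap 4 n m) (hI : I.IsPure xorAndPred) (W : Finset (Fin n)) (i : Fin m)
    (h : i ∈ flipped I W) : W.Nonempty := by
  obtain ⟨s, hs⟩ := touches_of_mem_flipped I hI W i h
  exact ⟨_, hs⟩

/-! ## Small sets: bound (A) certifies two flips -/

/-- **Bound (A) certificate**: `2·eL(W) + eA(W) + 2·eLA(W) + 2 ≤ volL(W) + volA(W)` forces `|Ψ(W)| ≥ 2`. -/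
theorem two_le_flipped_card_of_boundA (I : LocalMap 4 n m) (hI : I.IsPure xorAndPred) (W : Finset (Fin n))
    (h : 2 * eL I W + eA I W + 2 * eLA I W + 2 ≤ volL I W + volA I W) : 2 ≤ (flipped I W).card := by
  have hA := flipInequalityA I hI W
  omega

/-- **Size split.**  Bound (A) on the shadow-connected sets through `i` of size `< R` and the robust promise on those of
size `≥ R` isolate `1ᵐ ⊕ e_i` (`m ≥ 1600 n`). -/
theorem onesFlip_not_mem_range_split (I : LocalMap 4 n m) (hI : I.IsPure xorAndPred) (hn : 0 < n)
    (hm : 1600 * n ≤ m) (i : Fin m) (R : ℕ)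
    (hsmall : ∀ W : Finset (Fin n), ShadowConnected I W → i ∈ flipped I W → W.card < R →
      2 * eL I W + eA I W + 2 * eLA I W + 2 ≤ volL I W + volA I W)
    (hlarge : ∀ W : Finset (Fin n), ShadowConnected I W → i ∈ flipped I W → R ≤ W.card →
      PseudoRandomWAt (1 / 50) 2 2 I W) :
    onesFlip i ∉ I.range :=
  onesFlip_not_mem_range_of_two_le I hI i fun W hW hiW => by
    by_cases hR : W.card < R
    · exact two_le_flipped_card_of_boundA I hI W (hsmall W hW hiW hR)
    · exact two_le_flipped_card_W_at I hI hn hm W (nonempty_of_mem_flipped I hI W i hiW)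
        (hlarge W hW hiW (Nat.not_lt.1 hR))

/-! ## Shadow balls: a connected set lies in a small ball around each of its points -/

/-- One step of the shadow neighbourhood: add every variable of every output that reads a variable of `S`. -/
def shadowStep (I : LocalMap 4 n m) (S : Finset (Fin n)) : Finset (Fin n) :=
  S ∪ univ.filter fun v => ∃ j : Fin m, ∃ s t : Fin 4, I.vars j s ∈ S ∧ I.vars j t = v

/-- The shadow ball of radius `r` around `S`. -/
def shadowBall (I : LocalMap 4 n m) (S : Finset (Fin n)) : ℕ → Finset (Fin n)
  | 0 => S
  | r + 1 => shadowStep I (shadowBall I S r)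

/-- `S ⊆ shadowStep S`. -/
theorem subset_shadowStep (I : LocalMap 4 n m) (S : Finset (Fin n)) : S ⊆ shadowStep I S :=
  Finset.subset_union_left

/-- The shadow step is monotone. -/
theorem shadowStep_mono (I : LocalMap 4 n m) {S T : Finset (Fin n)} (h : S ⊆ T) : shadowStep I S ⊆ shadowStep I T := by
  intro v hv
  rcases Finset.mem_union.1 hv with hv | hv
  · exact Finset.mem_union_left _ (h hv)
  · refine Finset.mem_union_right _ ?_
    simp only [Finset.mem_filter, Finset.mem_univ, true_and] at hv ⊢
    obtain ⟨j, s, t, hs, ht⟩ := hv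
    exact ⟨j, s, t, h hs, ht⟩

/-- All variables of an output touching `S` lie in `shadowStep S`. -/
theorem vars_mem_shadowStep (I : LocalMap 4 n m) (S : Finset (Fin n)) (j : Fin m) (hj : Touches I j S) (t : Fin 4) :
    I.vars j t ∈ shadowStep I S := by
  obtain ⟨s, hs⟩ := hj
  refine Finset.mem_union_right _ ?_
  simp only [Finset.mem_filter, Finset.mem_univ, true_and]
  exact ⟨j, s, t, hs, rfl⟩

/-- `S ⊆ shadowBall S r`. -/
theorem subset_shadowBall (I : LocalMap 4 n m) (S : Finset (Fin n)) : ∀ r, S ⊆ shadowBall I S r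
  | 0 => Finset.Subset.refl _
  | r + 1 => (subset_shadowBall I S r).trans (subset_shadowStep I _)

/-- The shadow ball is monotone in the radius. -/
theorem shadowBall_mono_radius (I : LocalMap 4 n m) (S : Finset (Fin n)) {r r' : ℕ} (h : r ≤ r') :
    shadowBall I S r ⊆ shadowBall I S r' := by
  induction h with
  | refl => exact Finset.Subset.refl _
  | step _ ih => exact ih.trans (subset_shadowStep I _)

/-- The shadow ball is monotone in the centre. -/
theorem shadowBall_mono (I : LocalMap 4 n m) {S T : Finset (Fin n)} (h : S ⊆ T) :
    ∀ r, shadowBall I S r ⊆ shadowBall I T r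
  | 0 => h
  | r + 1 => shadowStep_mono I (shadowBall_mono I h r)

/-- Growth of a connected set inside balls: `|shadowBall {v₀} k ∩ W| ≥ min (k+1) |W|`. -/
theorem card_inter_shadowBall_ge (I : LocalMap 4 n m) (W : Finset (Fin n)) (hW : ShadowConnected I W) (v₀ : Fin n)
    (hv : v₀ ∈ W) : ∀ k : ℕ, min (k + 1) W.card ≤ (W ∩ shadowBall I {v₀} k).card := by
  intro k
  induction k with
  | zero =>
      have h1 : ({v₀} : Finset (Fin n)) ⊆ W ∩ shadowBall I {v₀} 0 := by
        intro v hv'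
        rw [Finset.mem_singleton] at hv'
        subst hv'
        exact Finset.mem_inter.2 ⟨hv, Finset.mem_singleton_self _⟩
      have := Finset.card_le_card h1
      rw [Finset.card_singleton] at this
      omega
  | succ k ih =>
      set A : Finset (Fin n) := W ∩ shadowBall I {v₀} k with hA
      have hAsub : A ⊆ W ∩ shadowBall I {v₀} (k + 1) :=
        Finset.inter_subset_inter_left (subset_shadowStep I _)
      by_cases hAW : A = W
      · have h1 : W.card ≤ (W ∩ shadowBall I {v₀} (k + 1)).card := by
          have := Finset.card_le_card hAsub
          rwa [hAW] at this
        omega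
      · -- `A` is a proper non-empty part of `W`: some output joins it to the rest, adding a new vertex to the next ball
        have hAne : A.Nonempty := ⟨v₀, Finset.mem_inter.2 ⟨hv, subset_shadowBall I {v₀} k (Finset.mem_singleton_self _)⟩⟩
        have hsep := hW A Finset.inter_subset_left hAne hAW
        unfold Separated at hsep
        push Not at hsep
        obtain ⟨j, hjA, hjW⟩ := hsep
        obtain ⟨t, ht⟩ := hjW
        rw [Finset.mem_sdiff] at ht
        have hnew : I.vars j t ∈ W ∩ shadowBall I {v₀} (k + 1) :=
          Finset.mem_inter.2 ⟨ht.1, vars_mem_shadowStep I _ j (hjA.mono Finset.inter_subset_right) t⟩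
        have hlt : A.card < (W ∩ shadowBall I {v₀} (k + 1)).card :=
          Finset.card_lt_card ⟨hAsub, fun hsub => ht.2 (hsub hnew)⟩
        omega

/-- **A shadow-connected set lies in the ball of radius `|W| − 1` around each of its points.** -/
theorem subset_shadowBall_of_connected (I : LocalMap 4 n m) (W : Finset (Fin n)) (hW : ShadowConnected I W)
    (v₀ : Fin n) (hv : v₀ ∈ W) : W ⊆ shadowBall I {v₀} (W.card - 1) := by
  have h := card_inter_shadowBall_ge I W hW v₀ hv (W.card - 1)
  have hpos : 0 < W.card := Finset.card_pos.2 ⟨v₀, hv⟩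
  have hmin : min (W.card - 1 + 1) W.card = W.card := by omega
  rw [hmin] at h
  have heq : W ∩ shadowBall I {v₀} (W.card - 1) = W :=
    Finset.eq_of_subset_of_card_le Finset.inter_subset_left h
  exact fun v hv' => (Finset.mem_inter.1 (heq.symm ▸ hv')).2

/-- The variables of output `i`. -/
def varSet (I : LocalMap 4 n m) (i : Fin m) : Finset (Fin n) := univ.image (I.vars i)

/-- A shadow-connected set flipping output `i` lies in the ball of radius `|W| − 1` around the variables of `i`. -/
theorem subset_shadowBall_varSet (I : LocalMap 4 n m) (hI : I.IsPure xorAndPred) (W : Finset (Fin n))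
    (hW : ShadowConnected I W) (i : Fin m) (hiW : i ∈ flipped I W) : W ⊆ shadowBall I (varSet I i) (W.card - 1) := by
  obtain ⟨s, hs⟩ := touches_of_mem_flipped I hI W i hiW
  refine (subset_shadowBall_of_connected I W hW _ hs).trans (shadowBall_mono I ?_ _)
  intro v hv
  rw [Finset.mem_singleton] at hv
  subst hv
  exact Finset.mem_image.2 ⟨s, Finset.mem_univ _, rfl⟩

/-! ## Regime 1 from occupancy on the set itself -/

/-- Occupancy of a variable: the number of slots (XOR or AND) holding it. -/
def occ (I : LocalMap 4 n m) (v : Fin n) : ℕ := degL I v + degA I v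

/-- Total volume is total occupancy. -/
theorem volL_add_volA_eq_sum_occ (I : LocalMap 4 n m) (W : Finset (Fin n)) :
    volL I W + volA I W = ∑ v ∈ W, occ I v := by
  rw [volL_eq_sum_degL, volA_eq_sum_degA, ← Finset.sum_add_distrib]
  rfl

/-- **Regime 1 from occupancy on `W`.**  If every variable OF `W` has occupancy `≥ (1−1/50)·4C`, the upper discrepancy
bounds hold at `W`, `10|W| ≤ 3n` and `m ≥ 1600 n`, then `|Ψ(W)| ≥ 2` (indeed `≥ (31C/50 − 14√C)|W|`). -/
theorem two_le_flipped_card_of_occ (I : LocalMap 4 n m) (hI : I.IsPure xorAndPred) (hn : 0 < n)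
    (hm : 1600 * n ≤ m) (W : Finset (Fin n)) (hW : W.Nonempty) (hreg : 10 * (W.card : ℝ) ≤ 3 * n)
    (hocc : ∀ v ∈ W, (1 - 1 / 50) * (4 * ((m : ℝ) / n)) ≤ (occ I v : ℝ))
    (heL : (eL I W : ℝ) ≤ (m : ℝ) / n ^ 2 * (W.card : ℝ) ^ 2 + 2 * Real.sqrt ((m : ℝ) / n) * W.card)
    (heA : (eA I W : ℝ) ≤ (m : ℝ) / n ^ 2 * (W.card : ℝ) ^ 2 + 2 * Real.sqrt ((m : ℝ) / n) * W.card)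
    (heLA : (eLA I W : ℝ) ≤ 4 * ((m : ℝ) / n ^ 2 * (W.card : ℝ) ^ 2) + 2 * 2 * Real.sqrt ((m : ℝ) / n) * W.card) :
    2 ≤ (flipped I W).card := by
  have hu : (1 : ℝ) ≤ W.card := by exact_mod_cast hW.card_pos
  have hn' : (0 : ℝ) < n := by exact_mod_cast hn
  have hC : (1600 : ℝ) ≤ (m : ℝ) / n := by
    rw [le_div_iff₀ hn']; exact_mod_cast hm
  set s : ℝ := Real.sqrt ((m : ℝ) / n) with hs
  have hs_sq : s ^ 2 = (m : ℝ) / n := Real.sq_sqrt (by positivity)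
  have hs0 : 0 ≤ s := Real.sqrt_nonneg _
  have hs40 : 40 ≤ s := by
    have h16 : Real.sqrt 1600 = 40 := by
      rw [show (1600 : ℝ) = 40 ^ 2 by norm_num]; exact Real.sqrt_sq (by norm_num)
    rw [← h16]; exact Real.sqrt_le_sqrt hC
  have hss : 40 * s ≤ s ^ 2 := by rw [sq]; exact mul_le_mul_of_nonneg_right hs40 hs0
  -- aggregate occupancy on `W`
  have hoccW : (1 - 1 / 50) * (4 * ((m : ℝ) / n)) * W.card ≤ (volL I W : ℝ) + volA I W := by
    have hsum : (volL I W : ℝ) + volA I W = ∑ v ∈ W, (occ I v : ℝ) := by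
      exact_mod_cast volL_add_volA_eq_sum_occ I W
    rw [hsum]
    calc (1 - 1 / 50) * (4 * ((m : ℝ) / n)) * W.card = ∑ v ∈ W, (1 - 1 / 50) * (4 * ((m : ℝ) / n)) := by
          rw [Finset.sum_const, nsmul_eq_mul]; ring
      _ ≤ ∑ v ∈ W, (occ I v : ℝ) := Finset.sum_le_sum fun v hv => hocc v hv
  have hA : volL I W + volA I W ≤ (flipped I W).card + 2 * eL I W + eA I W + 2 * eLA I W :=
    flipInequalityA I hI W
  have hA' : (volL I W : ℝ) + volA I W ≤
      ((flipped I W).card : ℝ) + 2 * (eL I W : ℝ) + eA I W + 2 * (eLA I W : ℝ) := by exact_mod_cast hA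
  have hQ : (m : ℝ) / n ^ 2 * (W.card : ℝ) ^ 2 ≤ 3 / 10 * ((m : ℝ) / n) * W.card := by
    have h1 : (m : ℝ) / n ^ 2 * (W.card : ℝ) ^ 2 = ((m : ℝ) / n * W.card) * ((W.card : ℝ) / n) := by
      field_simp
    have h2 : (W.card : ℝ) / n ≤ 3 / 10 := by
      rw [div_le_iff₀ hn']; linarith
    have h3 : (0 : ℝ) ≤ (m : ℝ) / n * W.card := by positivity
    rw [h1]
    calc (m : ℝ) / n * W.card * ((W.card : ℝ) / n) ≤ (m : ℝ) / n * W.card * (3 / 10) :=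
          mul_le_mul_of_nonneg_left h2 h3
      _ = 3 / 10 * ((m : ℝ) / n) * W.card := by ring
  suffices h : (2 : ℝ) ≤ ((flipped I W).card : ℝ) by exact_mod_cast h
  have hb : (31 / 50 * ((m : ℝ) / n) - 14 * s) * W.card ≤ ((flipped I W).card : ℝ) := by
    linarith [hoccW, heL, heA, heLA, hA', hQ]
  have hpos : (2 : ℝ) ≤ 31 / 50 * ((m : ℝ) / n) - 14 * s := by
    rw [← hs_sq]; linarith [hss, hs40]
  have hmono : (31 / 50 * ((m : ℝ) / n) - 14 * s) * 1 ≤ (31 / 50 * ((m : ℝ) / n) - 14 * s) * W.card :=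
    mul_le_mul_of_nonneg_left hu (by linarith)
  linarith

/-! ## The packaged defect-tolerant criterion -/

/-- Upper discrepancy of the three derived multigraphs (the one-sided part of `PseudoRandomW (1/50) 2 2` that regime 1
uses), at every vertex set. -/
def UpperDiscrepancy (I : LocalMap 4 n m) : Prop :=
  ∀ U : Finset (Fin n),
    (eL I U : ℝ) ≤ (m : ℝ) / n ^ 2 * (U.card : ℝ) ^ 2 + 2 * Real.sqrt ((m : ℝ) / n) * U.card ∧
    (eA I U : ℝ) ≤ (m : ℝ) / n ^ 2 * (U.card : ℝ) ^ 2 + 2 * Real.sqrt ((m : ℝ) / n) * U.card ∧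
    (eLA I U : ℝ) ≤ 4 * ((m : ℝ) / n ^ 2 * (U.card : ℝ) ^ 2) + 2 * 2 * Real.sqrt ((m : ℝ) / n) * U.card

/-- The robust promise implies upper discrepancy. -/
theorem upperDiscrepancy_of_pseudoRandomW (I : LocalMap 4 n m) (hR : PseudoRandomW (1 / 50) 2 2 I) :
    UpperDiscrepancy I := fun U => by
  obtain ⟨-, -, -, h1, h2, h3⟩ := hR U
  exact ⟨h1, h2, h3⟩

/-- **Defect-tolerant local isolation (U20, core).**  Fix an output `i` and a size threshold `R` with `10R ≤ 3n`.
If every variable within shadow-distance `R − 1` of the variables of `i` has occupancy `≥ (1−1/50)·4C` (no occupancy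
DEFECT near `i`), upper discrepancy holds, and the robust promise `PseudoRandomWAt (1/50) 2 2` — whose occupancy clause
is AGGREGATE — holds at every shadow-connected `W` with `i ∈ Ψ(W)` and `|W| ≥ R`, then `1ᵐ ⊕ e_i` is outside the range
(`m ≥ 1600 n`).  Far defects and aggregate-only occupancy on large sets are tolerated. -/
theorem onesFlip_not_mem_range_of_defectFar (I : LocalMap 4 n m) (hI : I.IsPure xorAndPred) (hn : 0 < n)
    (hm : 1600 * n ≤ m) (i : Fin m) (R : ℕ) (hR : 10 * (R : ℝ) ≤ 3 * n)
    (hocc : ∀ v ∈ shadowBall I (varSet I i) (R - 1), (1 - 1 / 50) * (4 * ((m : ℝ) / n)) ≤ (occ I v : ℝ))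
    (hdisc : UpperDiscrepancy I)
    (hlarge : ∀ W : Finset (Fin n), ShadowConnected I W → i ∈ flipped I W → R ≤ W.card →
      PseudoRandomWAt (1 / 50) 2 2 I W) :
    onesFlip i ∉ I.range :=
  onesFlip_not_mem_range_of_two_le I hI i fun W hW hiW => by
    by_cases hRW : W.card < R
    · have hsub : W ⊆ shadowBall I (varSet I i) (R - 1) :=
        (subset_shadowBall_varSet I hI W hW i hiW).trans (shadowBall_mono_radius I _ (by omega))
      have hreg : 10 * (W.card : ℝ) ≤ 3 * n := by
        have : (W.card : ℝ) ≤ R := by exact_mod_cast hRW.le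
        linarith
      obtain ⟨h1, h2, h3⟩ := hdisc W
      exact two_le_flipped_card_of_occ I hI hn hm W (nonempty_of_mem_flipped I hI W i hiW) hreg
        (fun v hv => hocc v (hsub hv)) h1 h2 h3
    · exact two_le_flipped_card_W_at I hI hn hm W (nonempty_of_mem_flipped I hI W i hiW)
        (hlarge W hW hiW (Nat.not_lt.1 hRW))

/-- **Corollary (global form).**  Under the robust promise `PseudoRandomW (1/50) 2 2` RESTRICTED to sets of size `≥ R`
(plus its upper-discrepancy part everywhere), every output whose `(R−1)`-shadow-ball is free of occupancy defects is
isolated. -/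
theorem onesFlip_not_mem_range_of_defectFar' (I : LocalMap 4 n m) (hI : I.IsPure xorAndPred) (hn : 0 < n)
    (hm : 1600 * n ≤ m) (i : Fin m) (R : ℕ) (hR : 10 * (R : ℝ) ≤ 3 * n)
    (hocc : ∀ v ∈ shadowBall I (varSet I i) (R - 1), (1 - 1 / 50) * (4 * ((m : ℝ) / n)) ≤ (occ I v : ℝ))
    (hdisc : UpperDiscrepancy I)
    (hlarge : ∀ W : Finset (Fin n), R ≤ W.card → PseudoRandomWAt (1 / 50) 2 2 I W) :
    onesFlip i ∉ I.range :=
  onesFlip_not_mem_range_of_defectFar I hI hn hm i R hR hocc hdisc fun W _ _ hW => hlarge W hW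

end Summit.PneNP.PneNP.Theorems.PstarIsolationDefects
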